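import Literature.Geometry.Riemannian.ModelTransport
import Literature.Geometry.Riemannian.CanonicalNeighbourhoods
import Literature.Geometry.Lorentzian.IsometryProofs
import Literature.Geometry.Lorentzian.CurvatureNaturality
import Literature.Geometry.Lorentzian.LeviCivitaCurvature
import HarnessLib

/-!
# Transport of a metric to the Euclidean-model structure of the same manifold:
# values, distance, balls, volume and curvature bounds are unchanged

Let `M` be a `C^∞` manifold modelled on `I : ModelWithCorners ℝ E H` and `e : E ≃L[ℝ] E'` a
continuous linear equivalence (for instance `E' = EuclideanSpace ℝ (Fin (dim E))`). On the SAME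
type `M`, with the same charts, Mathlib provides the model `I.transContinuousLinearEquiv e`
(`ModelTransport.lean` for the differentials). A pseudo-Riemannian metric `g` on `TM` (fibres
`T_x M = E`) is transported to the metric `g.transportCLE e` on the tangent bundle of the new
structure (fibres `E'`): the pullback `id^* g` along the identity `(M, I.trans e) → (M, I)` in the
sense of `PseudoRiemannianMetric.comap` (`Isometry.lean`; O'Neill 1983, Ch. 3, p. 58, pp. 90–91),
i.e. `(g.transportCLE e)_x (v, w) = g_x (e⁻¹ v, e⁻¹ w)`. Being an isometry in every sense, the
identity preserves every metric quantity; this file PROVES the ones entering Perelman's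
`κ`-noncollapsing (`IsKappaNoncollapsed`, `CanonicalNeighbourhoods.lean`):

* `transportCLE`, `transportCLE_val_apply`, `isRiemannian_transportCLE`;
* `riemannianEDist_transportCLE`, `edist_transportCLE`, `riemEDist_transportCLE`,
  `ball_transportCLE` — the length distance and the geodesic balls are the same sets
  (`C¹` paths and their speeds correspond under `e`, `mfderiv_transCLE_right`);
* `riemVolume_transportCLE`, `vol_transportCLE` — the Riemannian measure (Euclidean-normalised
  Hausdorff measure of the length distance, `Volume.lean`) is the same measure (the identity is
  an isometry of the two length structures, and `dim E' = dim E`);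
* `curvatureForm_transportCLE`, `curvatureBoundedOn_transportCLE_iff` — `Rm` of the transported
  metric is `Rm` of `g` on the corresponding vectors (naturality of the Riemann tensor under the
  local isometry `id`, `riemann_comap_apply`, `CurvatureNaturality.lean`; O'Neill 1983, Ch. 3,
  Prop. 3.59), for any Levi-Civita connections on the two sides
  (`IsLeviCivita.curvature_eq_riemann`), so frame-wise curvature bounds are equivalent.

Everything is proved; the file introduces the definition `transportCLE` (an abbreviation for a
`comap`) and no statement of `Prop` type.

## References

* B. O'Neill, *Semi-Riemannian geometry with applications to relativity*, Academic Press 1983,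
  Ch. 3, p. 58 (pullback), Prop. 3.59 and pp. 90–91 (isometries preserve the Levi-Civita
  connection, curvature, and are local isometries of the length structures); Ch. 5, Def. 15,
  Prop. 18 (Riemannian distance). [ONeill1983]
* J. M. Lee, *Introduction to Riemannian Manifolds*, 2nd ed., Springer 2018, Prop. 2.51 and
  Thm. 7.10 ff. ("local isometries preserve curvature"); Lemma 6.? (isometries preserve lengths
  of curves and the Riemannian distance). [Lee2018]
* H. Federer, *Geometric Measure Theory* (1969), §2.10.11 (isometries preserve Hausdorff
  measures). [Federer1969]
-/

noncomputable section

open Set Function Manifold Bundle MeasureTheory Module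
open scoped Manifold ContDiff Topology ENNReal

namespace Literature.Geometry.Riemannian

open Lorentzian Lorentzian.PseudoRiemannianMetric

variable {E : Type*} [NormedAddCommGroup E] [NormedSpace ℝ E] [FiniteDimensional ℝ E]
  {E' : Type*} [NormedAddCommGroup E'] [NormedSpace ℝ E'] [FiniteDimensional ℝ E']
  {H : Type*} [TopologicalSpace H] {I : ModelWithCorners ℝ E H}
  {M : Type*} [TopologicalSpace M] [ChartedSpace H M] [IsManifold I ∞ M]

omit [FiniteDimensional ℝ E] [FiniteDimensional ℝ E'] in
/-- Isomorphic finite-dimensional spaces have the same dimension (in the order consumed by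
`PseudoRiemannianMetric.comap`). [folklore] -/
theorem finrank_eq_of_cle (e : E ≃L[ℝ] E') : finrank ℝ E' = finrank ℝ E :=
  e.symm.toLinearEquiv.finrank_eq

/-- **The metric transported to the structure with model `I.trans e`**: the pullback `id^* g` of
`g` along the identity `(M, I.transContinuousLinearEquiv e) → (M, I)` (a diffeomorphism with
differential `e⁻¹`, `mfderiv_id_transCLE`), i.e. the same scalar products read through `e`:
`(g.transportCLE e)_x (v, w) = g_x (e⁻¹ v, e⁻¹ w)`. O'Neill 1983, Ch. 3, p. 58 (pullback metric)
and pp. 90–91. [cite: ONeill1983, Ch. 3, p. 58 and pp. 90–91] -/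
def _root_.Literature.Geometry.Lorentzian.PseudoRiemannianMetric.transportCLE
    (g : PseudoRiemannianMetric I ∞ E (TangentSpace I : M → Type _)) (e : E ≃L[ℝ] E') :
    PseudoRiemannianMetric (I.transContinuousLinearEquiv e) ∞ E'
      (TangentSpace (I.transContinuousLinearEquiv e) : M → Type _) :=
  g.comap (I' := I.transContinuousLinearEquiv e) contMDiff_pullbackBilin_holds (id : M → M)
    (contMDiff_id_transCLE I e) (injective_mfderiv_id_transCLE I e) (finrank_eq_of_cle e)

variable (g : PseudoRiemannianMetric I ∞ E (TangentSpace I : M → Type _)) (e : E ≃L[ℝ] E')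

/-- Unfolding: `transportCLE` is the `comap` along the identity. [folklore] -/
theorem transportCLE_def : g.transportCLE e =
    g.comap (I' := I.transContinuousLinearEquiv e) contMDiff_pullbackBilin_holds (id : M → M)
      (contMDiff_id_transCLE I e) (injective_mfderiv_id_transCLE I e) (finrank_eq_of_cle e) :=
  rfl

/-- **The transported scalar products**: `(g.transportCLE e)_x (v, w) = g_x (e⁻¹ v, e⁻¹ w)`.
[cite: ONeill1983, Ch. 3, p. 58] -/
@[simp] theorem transportCLE_val_apply (x : M) (v w : E') :
    (g.transportCLE e).val x v w = g.val x (e.symm v) (e.symm w) := by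
  simp only [transportCLE_def, val_comap, pullbackBilin_apply, mfderiv_id_transCLE_apply]
  rfl

variable {g}

/-- The transport of a Riemannian metric is Riemannian. [folklore] -/
theorem isRiemannian_transportCLE (hg : g.IsRiemannian) : (g.transportCLE e).IsRiemannian := by
  intro x v hv
  rw [transportCLE_val_apply]
  refine hg x (e.symm v) fun h0 ↦ hv ?_
  change (e.symm : E' → E) v = (0 : E) at h0
  exact (map_eq_zero_iff e.symm e.symm.injective).1 h0

/-! ### The length distance and the geodesic balls -/

/-- The norms of corresponding tangent vectors agree: `|e v|_{g.transportCLE e} = |v|_g`.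
[folklore] -/
theorem norm_transportCLE (hg : g.IsRiemannian) (x : M) (v : TangentSpace I x) :
    (letI := (g.transportCLE e).riemannianBundle (isRiemannian_transportCLE e hg);
      @Norm.norm (TangentSpace (I.transContinuousLinearEquiv e) x) _ (e v)) =
    (letI := g.riemannianBundle hg; ‖v‖) := by
  rw [(g.transportCLE e).norm_eq_sqrt (isRiemannian_transportCLE e hg) x (e v),
    g.norm_eq_sqrt hg x v, transportCLE_val_apply, e.symm_apply_apply]

/-- **The length distance is unchanged**: for the Riemannian bundle structures of
`g.transportCLE e` on `(M, I.trans e)` and of `g` on `(M, I)`, Mathlib's `riemannianEDist`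
(infimum of lengths of `C¹` paths) agree — the `C¹` paths are the same
(`contMDiff_transContinuousLinearEquiv_right`) and their speeds correspond under `e`
(`mfderiv_transCLE_right`), with equal norms. O'Neill 1983, Ch. 5, Def. 15 ff. (isometries
preserve arc length and distance). [cite: ONeill1983, Ch. 5, Def. 15] -/
theorem riemannianEDist_transportCLE (hg : g.IsRiemannian) (x y : M) :
    (letI := (g.transportCLE e).riemannianBundle (isRiemannian_transportCLE e hg);
      riemannianEDist (I.transContinuousLinearEquiv e) x y) =
    (letI := g.riemannianBundle hg; riemannianEDist I x y) := by
  letI i₁ := (g.transportCLE e).riemannianBundle (isRiemannian_transportCLE e hg)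
  letI i₂ := g.riemannianBundle hg
  simp only [riemannianEDist]
  refine iInf_congr fun γ ↦ ?_
  refine iInf_congr_Prop (ContinuousLinearEquiv.contMDiff_transContinuousLinearEquiv_right e) ?_
  intro _
  refine lintegral_congr fun t ↦ ?_
  rw [mfderiv_transCLE_right_apply, ← ofReal_norm, ← ofReal_norm]
  congr 1
  exact norm_transportCLE e hg (γ t) _

/-- **The Riemannian distance is unchanged** (`PseudoRiemannianMetric.edist`,
`RiemannianDistance.lean`; O'Neill 1983, Ch. 5, Def. 15). [cite: ONeill1983, Ch. 5, Def. 15] -/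
theorem edist_transportCLE (hg : g.IsRiemannian) (x y : M) :
    (g.transportCLE e).edist (isRiemannian_transportCLE e hg) x y = g.edist hg x y :=
  riemannianEDist_transportCLE e hg x y

/-- The total form of the distance is unchanged. [folklore] -/
theorem riemEDist_transportCLE (hg : g.IsRiemannian) :
    (g.transportCLE e).riemEDist = g.riemEDist := by
  funext x y
  rw [riemEDist_eq (isRiemannian_transportCLE e hg), riemEDist_eq hg, edist_transportCLE]

/-- **The geodesic balls are the same sets.** [cite: ONeill1983, Ch. 5, Def. 15 (p. 134)] -/
theorem ball_transportCLE (hg : g.IsRiemannian) (x : M) (r : ℝ≥0∞) :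
    (g.transportCLE e).ball x r = g.ball x r := by
  ext y
  simp only [PseudoRiemannianMetric.mem_ball, riemEDist_transportCLE e hg]

/-! ### The Riemannian measure -/

section Volume

variable [T3Space M] [MeasurableSpace M] [BorelSpace M]

/-- **The Riemannian measure is unchanged.** Both `(g.transportCLE e).riemVolume` and
`g.riemVolume` are the Euclidean-normalised `dim`-dimensional Hausdorff measures of length
distances on `M` which coincide (`riemannianEDist_transportCLE`), and `dim E' = dim E`; an
isometry (here the identity between the two length structures) preserves Hausdorff measures
(Federer 1969, §2.10.11; Mathlib's `Isometry.hausdorffMeasure_image`).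
[cite: Federer1969, §2.10.11] -/
theorem riemVolume_transportCLE (hg : g.IsRiemannian) :
    (g.transportCLE e).riemVolume = g.riemVolume := by
  have hĝ := isRiemannian_transportCLE e hg
  rw [riemVolume_eq hĝ, riemVolume_eq hg]
  -- the two emetric structures on `M`
  letI i₁ := (g.transportCLE e).riemannianBundle hĝ
  letI i₂ := g.riemannianBundle hg
  haveI := (g.transportCLE e).isContinuousRiemannianBundle hĝ
  haveI := g.isContinuousRiemannianBundle hg
  let m₁ : EMetricSpace M := EMetricSpace.ofRiemannianMetric (I.transContinuousLinearEquiv e) M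
  let m₂ : EMetricSpace M := EMetricSpace.ofRiemannianMetric I M
  -- the identity is an isometry `(M, m₂) → (M, m₁)`
  have hiso : @Isometry M M m₂.toPseudoEMetricSpace m₁.toPseudoEMetricSpace id := fun x y ↦
    riemannianEDist_transportCLE e hg x y
  have hH : ∀ (d : ℝ) (s : Set M), @Measure.hausdorffMeasure M m₁ _ _ d s =
      @Measure.hausdorffMeasure M m₂ _ _ d s := by
    intro d s
    have h := @Isometry.hausdorffMeasure_image M M m₂ m₁ _ _ _ _ id d hiso
      (Or.inr surjective_id) s
    rwa [image_id] at h
  have hμ : ∀ d : ℕ, @Measure.euclideanHausdorffMeasure M m₁ _ _ d =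
      @Measure.euclideanHausdorffMeasure M m₂ _ _ d := by
    intro d
    have hHd : @Measure.hausdorffMeasure M m₁ _ _ (d : ℝ) = @Measure.hausdorffMeasure M m₂ _ _ (d : ℝ) :=
      Measure.ext fun s _ ↦ hH d s
    rw [@Measure.euclideanHausdorffMeasure_def M m₁, @Measure.euclideanHausdorffMeasure_def M m₂, hHd]
  show @Measure.euclideanHausdorffMeasure M m₁ _ _ (finrank ℝ E') =
    @Measure.euclideanHausdorffMeasure M m₂ _ _ (finrank ℝ E)
  rw [finrank_eq_of_cle e]
  exact hμ _

/-- **Volumes are unchanged**: `Vol_{g.transportCLE e}(s) = Vol_g(s)`. [cite: Federer1969, §2.10.11] -/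
theorem vol_transportCLE (hg : g.IsRiemannian) (s : Set M) :
    (g.transportCLE e).vol s = g.vol s := by
  rw [PseudoRiemannianMetric.vol, PseudoRiemannianMetric.vol, riemVolume_transportCLE e hg]

end Volume

/-! ### Curvature -/

section Curvature

variable {cov : CovariantDerivative I E (TangentSpace I : M → Type _)}
  {cov' : CovariantDerivative (I.transContinuousLinearEquiv e) E'
    (TangentSpace (I.transContinuousLinearEquiv e) : M → Type _)}

/-- **The Riemann tensor of the transported metric** (naturality of curvature under the local
isometry `id : (M, I.trans e) → (M, I)`, `riemann_comap_apply`; O'Neill 1983, Ch. 3, Prop. 3.59):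
for Levi-Civita connections `cov` of `g` and `cov'` of `g.transportCLE e`,
`Rm'(X, Y, Z, W) = Rm(e⁻¹X, e⁻¹Y, e⁻¹Z, e⁻¹W)`. [cite: ONeill1983, Ch. 3, Prop. 3.59] -/
theorem curvatureForm_transportCLE (hcov : g.IsLeviCivita cov)
    (hcov' : (g.transportCLE e).IsLeviCivita cov') (x : M) (X Y Z W : E') :
    (g.transportCLE e).curvatureForm cov' x X Y Z W =
      g.curvatureForm cov x (e.symm X) (e.symm Y) (e.symm Z) (e.symm W) := by
  haveI : CompleteSpace E := FiniteDimensional.complete ℝ E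
  haveI : CompleteSpace E' := FiniteDimensional.complete ℝ E'
  haveI := g.hasLeviCivita
  haveI := (g.transportCLE e).hasLeviCivita
  have h2 : (2 : ℕ∞ω) ≤ (∞ : ℕ∞ω) := WithTop.coe_le_coe.mpr le_top
  haveI : (g.comap (I' := I.transContinuousLinearEquiv e) contMDiff_pullbackBilin_holds
      (id : M → M) (contMDiff_id_transCLE I e) (injective_mfderiv_id_transCLE I e)
      (finrank_eq_of_cle e)).HasLeviCivita := (g.transportCLE e).hasLeviCivita
  simp only [PseudoRiemannianMetric.curvatureForm]
  rw [hcov'.curvature_eq_riemann h2 x, hcov.curvature_eq_riemann h2 x]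
  have hR : (g.transportCLE e).riemann x X Y Z =
      (mfderiv (I.transContinuousLinearEquiv e) I (id : M → M) x).inverse
        (g.riemann x (mfderiv (I.transContinuousLinearEquiv e) I (id : M → M) x X)
          (mfderiv (I.transContinuousLinearEquiv e) I (id : M → M) x Y)
          (mfderiv (I.transContinuousLinearEquiv e) I (id : M → M) x Z)) :=
    g.riemann_comap_apply (I' := I.transContinuousLinearEquiv e)
      contMDiff_pullbackBilin_holds (contMDiff_id_transCLE I e) (injective_mfderiv_id_transCLE I e)
      (finrank_eq_of_cle e) x X Y Z
  have hinv : (mfderiv (I.transContinuousLinearEquiv e) I (id : M → M) x).inverse =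
      ((e : E ≃L[ℝ] E') : E →L[ℝ] E') := by
    rw [mfderiv_id_transCLE]
    exact (ContinuousLinearMap.inverse_equiv e.symm).trans (by rw [e.symm_symm])
  rw [hR, transportCLE_val_apply, hinv, mfderiv_id_transCLE_apply, mfderiv_id_transCLE_apply,
    mfderiv_id_transCLE_apply]
  change g.val x (e.symm (e (g.riemann x (e.symm X) (e.symm Y) (e.symm Z)))) (e.symm W) = _
  rw [e.symm_apply_apply]

/-- **Frame-wise curvature bounds are equivalent** for `g` and its transport (same constant, same
set): `CurvatureBoundedOn (g.transportCLE e) cov' U C ↔ CurvatureBoundedOn g cov U C` for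
Levi-Civita connections `cov, cov'` (the unit vectors and the values of `Rm` correspond under
`e`). [cite: ONeill1983, Ch. 3, Prop. 3.59] -/
theorem curvatureBoundedOn_transportCLE_iff (hcov : g.IsLeviCivita cov)
    (hcov' : (g.transportCLE e).IsLeviCivita cov') (U : Set M) (C : ℝ) :
    CurvatureBoundedOn (g.transportCLE e) cov' U C ↔ CurvatureBoundedOn g cov U C := by
  constructor
  · intro h x hx X Y Z W hX hY hZ hW
    have h' := h x hx (e X) (e Y) (e Z) (e W)
      (by rw [transportCLE_val_apply, e.symm_apply_apply]; exact hX)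
      (by rw [transportCLE_val_apply, e.symm_apply_apply]; exact hY)
      (by rw [transportCLE_val_apply, e.symm_apply_apply]; exact hZ)
      (by rw [transportCLE_val_apply, e.symm_apply_apply]; exact hW)
    rwa [curvatureForm_transportCLE e hcov hcov', e.symm_apply_apply, e.symm_apply_apply,
      e.symm_apply_apply, e.symm_apply_apply] at h'
  · intro h x hx X Y Z W hX hY hZ hW
    rw [curvatureForm_transportCLE e hcov hcov']
    rw [transportCLE_val_apply] at hX hY hZ hW
    exact h x hx _ _ _ _ hX hY hZ hW

end Curvature

end Literature.Geometry.Riemannian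

end
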